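import Summits.Ventures.PercRepro.Night2FatDDShape
import Summits.Ventures.PercRepro.Night2FatDDComb2
import Summits.Ventures.PercRepro.Night2FatDDCells
import Summits.Ventures.PercRepro.Night2FatDegCountB
import Summits.Ventures.PercRepro.Night2FatDDLargeComb
import Summits.Ventures.PercRepro.Night2FatDDLargeNum

/-!
# night-2: the doubly degenerate regime for `N ≥ 11` — every lossy basis pair

**`basis_pair_fair_fat_dd_large`**: a lossy basis pair of the doubly degenerate regime with `N = |G ∖ Q| ≥ 11`
(`m = |W ∖ {x}| ≥ 10`) has the fair share.  A side line (`clF A`, `clF M`) is HEAVY when it is non-class with two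
basis points — then its points are not unloaded singletons and the sets inside it are loaded; otherwise every set
off the spine's conditions is fine.  Four cases (`dd_bridge_large`, levels `1, 2, 3, 4` with the capacity `11/18`):
* no heavy line: every singleton is unloaded (`dload_eq_zero_of_singleton_dd`), `e = m ≥ 10`;
* `clF A` heavy only: the singletons off `clF A` (`e = m − s₂ ≥ 3`) and the triples with two points of the `A`-cell
  and a point off `clF A` (`card_filter_two_off_ge`, unloaded by `dload_eq_zero_of_dd_family`: two points off the
  spine and off `clF M`, one point off `clF A`), `dd_large_one`;
* `clF M` heavy only: symmetric;
* both heavy: the singletons off both lines (`e ≥ m − s₂ − s₃`), the pairs and the triples meeting both side cells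
  (`card_filter_meets_two_ge`, `card_filter_meets_three_ge`), `dd_large_both` from the cell facts.
Paper `proofs/NIGHT-2-g36.md` §1.
-/

namespace PercRepro.Shadow

open PercRepro.ThmH PercRepro.PerFlat

variable {α : Type*} [DecidableEq α] {M : Matroid α} [M.Finite] {G : Finset α}

/-- **The fair share of every lossy basis pair of the doubly degenerate regime with `N ≥ 11`.** -/
theorem basis_pair_fair_fat_dd_large (hG : G ∈ flatsQ M (5 + 1)) (hd : (gr M \ G).card = 2)
    (hk : kColoops M G = 1) (hs : ∀ e ∈ gr M, ∀ f ∈ gr M, e ≠ f → rkN M {e, f} = 2)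
    (hl : ∀ e ∈ gr M, M.Indep {e}) (hfat : (fatClosures M 5 G 2).card ≤ 1) {B₀ : Finset α}
    (hB₀ : B₀ ∈ thinMembers M 5 G) {w₀ x : α} (hD : G \ clF M B₀ = {w₀, x}) (hne : w₀ ≠ x) {R₁ : Finset α}
    (hR₁V : R₁ ⊆ (G \ coloops M G) \ {w₀, x}) (hR₁2 : rkN M R₁ = 2) (hR₁3 : 3 ≤ R₁.card)
    (hcop : rkN M (insert w₀ (insert x R₁)) ≤ 3) {c₂ c₃ : α}
    (hc₂V : c₂ ∈ (G \ coloops M G) \ {w₀, x}) (hc₃V : c₃ ∈ (G \ coloops M G) \ {w₀, x})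
    (hc₂ : c₂ ∉ clF M R₁) (hc₃ : c₃ ∉ clF M (insert c₂ R₁))
    (hcover : ∀ e ∈ (G \ coloops M G) \ {w₀, x}, e ∈ clF M (insert c₂ R₁) ∨ e ∈ clF M (insert c₃ R₁))
    (hdeg₂ : rkN M (((G \ coloops M G) \ {w₀, x}).filter (fun e => e ∈ clF M (insert c₂ R₁) ∧ e ∉ clF M R₁)) ≤ 2)
    (hdeg₃ : rkN M (((G \ coloops M G) \ {w₀, x}).filter (fun e => e ∈ clF M (insert c₃ R₁) ∧ e ∉ clF M R₁)) ≤ 2)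
    {B : Finset α} (hB : B ∈ thinMembers M 5 G) (hnP : ¬ bigP M G B) {z : α} (hz : z ∈ G \ clF M B)
    (hl0 : loss M 5 G B z ≠ 0) (hw₀ : w₀ ∈ insert z B) (hx : x ∉ insert z B) (hN : 11 ≤ (G \ insert z B).card) :
    loss M 5 G B z ≤ rhoL M 5 G B z * lossIncomeH M 5 G (bigP M G) (dshGT2 M 5 G) B z := by
  -- the cell facts
  have hf := dd_cell_facts hG hd hk hs hfat hB₀ hD hne hR₁V hR₁2 hR₁3 hcop hc₂V hc₃V hc₂ hc₃ hcover hdeg₂ hdeg₃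
    hB hnP hz hw₀ hx
  dsimp only at hf
  obtain ⟨h1, h2, h3, h4, h5, h6, h7, h8, h9⟩ := hf
  have hPind : M.Indep ((((insert z B \ coloops M G).erase w₀) : Finset α) : Set α) :=
    basis_points_indep hG hd hk hB hnP hz
  have h10 := (card_filter_clF_le_rkN_of_indep (X := ((G \ coloops M G) \ {w₀, x}).filter
    (fun e => e ∈ clF M (insert c₂ R₁) ∧ e ∉ clF M R₁)) hPind).trans hdeg₂
  have h11 := (card_filter_clF_le_rkN_of_indep (X := ((G \ coloops M G) \ {w₀, x}).filter
    (fun e => e ∈ clF M (insert c₃ R₁) ∧ e ∉ clF M R₁)) hPind).trans hdeg₃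
  -- names
  set V := (G \ coloops M G) \ {w₀, x} with hV
  set P₀ := (insert z B \ coloops M G).erase w₀ with hP₀
  set W := (G \ insert z B).erase x with hW
  set Aset := V.filter (fun e => e ∈ clF M (insert c₂ R₁) ∧ e ∉ clF M R₁) with hAset
  set Mset := V.filter (fun e => e ∈ clF M (insert c₃ R₁) ∧ e ∉ clF M R₁) with hMset
  set A' := W.filter (fun e => e ∈ Aset) with hA'
  set M' := W.filter (fun e => e ∈ Mset) with hM'
  set L' := W.filter (fun e => e ∈ clF M R₁) with hL'
  -- the ambient facts
  have hGg : G ⊆ gr M := (mem_flatsQ.1 hG).1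
  have hVg : V ⊆ gr M := fun e he => hGg (Finset.mem_sdiff.1 (Finset.mem_sdiff.1 he).1).1
  have hR₁g : R₁ ⊆ gr M := hR₁V.trans hVg
  have hc₂g : c₂ ∈ gr M := hVg hc₂V
  have hc₃g : c₃ ∈ gr M := hVg hc₃V
  have hAg : Aset ⊆ gr M := (Finset.filter_subset _ _).trans hVg
  have hMg : Mset ⊆ gr M := (Finset.filter_subset _ _).trans hVg
  have hxGQ : x ∈ G \ insert z B := by
    have : x ∈ G \ clF M B₀ := by rw [hD]; exact Finset.mem_insert_of_mem (Finset.mem_singleton_self _)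
    exact Finset.mem_sdiff.2 ⟨(Finset.mem_sdiff.1 this).1, hx⟩
  have hWm : W.card + 1 = (G \ insert z B).card := by
    rw [hW, Finset.card_erase_of_mem hxGQ]
    have := Finset.card_pos.2 ⟨x, hxGQ⟩
    omega
  have hN3 : 3 ≤ (G \ insert z B).card := by omega
  have hN4 : 4 ≤ (G \ insert z B).card := by omega
  -- the geometry of the cells
  have hAL : ∀ e ∈ Aset, e ∉ clF M R₁ := fun e he => (Finset.mem_filter.1 he).2.2
  have hML : ∀ e ∈ Mset, e ∉ clF M R₁ := fun e he => (Finset.mem_filter.1 he).2.2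
  have hAπ : Aset ⊆ clF M (insert c₂ R₁) := fun e he => (Finset.mem_filter.1 he).2.1
  have hMπ : Mset ⊆ clF M (insert c₃ R₁) := fun e he => (Finset.mem_filter.1 he).2.1
  have hAcM : ∀ e ∈ Aset, e ∉ clF M Mset := fun e he h =>
    hAL e he (mem_clF_of_mem_two_planes hR₁g hc₂g hc₃g hc₂ hc₃ (hAπ he) (clF_subset_clF_of_subset_clF hMπ h))
  have hMcA : ∀ e ∈ Mset, e ∉ clF M Aset := fun e he h =>
    hML e he (mem_clF_of_mem_two_planes hR₁g hc₂g hc₃g hc₂ hc₃ (clF_subset_clF_of_subset_clF hAπ h) (hMπ he))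
  have hAcA : ∀ e ∈ Aset, e ∈ clF M Aset := fun e he => subset_clF_of_subset_gr hAg he
  have hMcM : ∀ e ∈ Mset, e ∈ clF M Mset := fun e he => subset_clF_of_subset_gr hMg he
  have hA'W : A' ⊆ W := Finset.filter_subset _ _
  have hM'W : M' ⊆ W := Finset.filter_subset _ _
  have hL'W : L' ⊆ W := Finset.filter_subset _ _
  have hA'C : A' ⊆ clF M Aset := fun e he => hAcA e (Finset.mem_filter.1 he).2
  have hM'C : M' ⊆ clF M Mset := fun e he => hMcM e (Finset.mem_filter.1 he).2
  have hdAM : Disjoint A' M' := by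
    rw [Finset.disjoint_left]
    intro e he he'
    exact hAcM e (Finset.mem_filter.1 he).2 (hMcM e (Finset.mem_filter.1 he').2)
  have hdAL : Disjoint A' L' := by
    rw [Finset.disjoint_left]
    intro e he he'
    exact hAL e (Finset.mem_filter.1 he).2 (Finset.mem_filter.1 he').2
  have hdML : Disjoint M' L' := by
    rw [Finset.disjoint_left]
    intro e he he'
    exact hML e (Finset.mem_filter.1 he).2 (Finset.mem_filter.1 he').2
  -- the singletons: the points off the heavy lines
  set E := W.filter (fun y =>
    ((2 ≤ (P₀.filter (fun e => e ∈ clF M Aset)).card ∧ ¬ rkN M (insert w₀ (insert x Aset)) ≤ 3) →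
      y ∉ clF M Aset) ∧
    ((2 ≤ (P₀.filter (fun e => e ∈ clF M Mset)).card ∧ ¬ rkN M (insert w₀ (insert x Mset)) ≤ 3) →
      y ∉ clF M Mset)) with hE
  have hEcard : W.card -
      (if 2 ≤ (P₀.filter (fun e => e ∈ clF M Aset)).card ∧ ¬ rkN M (insert w₀ (insert x Aset)) ≤ 3 then
        (W.filter (fun e => e ∈ clF M Aset)).card else 0) -
      (if 2 ≤ (P₀.filter (fun e => e ∈ clF M Mset)).card ∧ ¬ rkN M (insert w₀ (insert x Mset)) ≤ 3 then
        (W.filter (fun e => e ∈ clF M Mset)).card else 0) ≤ E.card :=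
    card_filter_singletons_ge W (clF M Aset) (clF M Mset)
      (2 ≤ (P₀.filter (fun e => e ∈ clF M Aset)).card ∧ ¬ rkN M (insert w₀ (insert x Aset)) ≤ 3)
      (2 ≤ (P₀.filter (fun e => e ∈ clF M Mset)).card ∧ ¬ rkN M (insert w₀ (insert x Mset)) ≤ 3)
  have hEW : E ⊆ W := Finset.filter_subset _ _
  have hEun : ∀ T ∈ tgtSets M 5 G B z, x ∈ T → (T \ insert z B).card = 2 → (T \ insert z B).erase x ⊆ E →
      dload M 5 G (bigP M G) (dshGT2 M 5 G) T = 0 := by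
    intro T hT hxT hT2 hYE
    have hxTQ : x ∈ T \ insert z B := Finset.mem_sdiff.2 ⟨hxT, hx⟩
    obtain ⟨y, hy⟩ : ((T \ insert z B).erase x).Nonempty := by
      rw [← Finset.card_pos, Finset.card_erase_of_mem hxTQ, hT2]; norm_num
    have hyE := Finset.mem_filter.1 (hYE hy)
    exact dload_eq_zero_of_singleton_dd hG hd hk hs hl hfat hB₀ hD hne hR₁V hR₁2 hR₁3 hc₂V hc₃V hc₂ hc₃ hcover
      hdeg₂ hdeg₃ hB hnP hz hw₀ hx hT hxT hT2 hy (fun _ hc => absurd hcop hc) (fun h2 hc => hyE.2.1 ⟨h2, hc⟩)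
      (fun h2 hc => hyE.2.2 ⟨h2, hc⟩)
  -- the spine conditions of a set with two points of the side cells
  have hspine : ∀ Y : Finset α, ∀ a ∈ Y, ∀ b ∈ Y, a ≠ b → a ∉ clF M R₁ → b ∉ clF M R₁ →
      (2 ≤ (P₀.filter (fun e => e ∈ clF M R₁)).card → rkN M (insert w₀ (insert x R₁)) ≤ 3 →
        2 ≤ (Y \ clF M R₁).card) ∧
      (2 ≤ (P₀.filter (fun e => e ∈ clF M R₁)).card → ¬ rkN M (insert w₀ (insert x R₁)) ≤ 3 →
        3 ≤ (W \ Y).card → ¬ Y ⊆ clF M R₁) ∧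
      ((P₀.filter (fun e => e ∈ clF M R₁)).card = 1 → rkN M (insert w₀ (insert x R₁)) ≤ 3 → ¬ Y ⊆ clF M R₁) := by
    intro Y a ha b hb hab haL hbL
    refine ⟨fun _ _ => ?_, fun _ hc => absurd hcop hc, fun _ _ hsub => haL (hsub ha)⟩
    have hsub : ({a, b} : Finset α) ⊆ Y \ clF M R₁ := by
      intro e he
      rw [Finset.mem_insert, Finset.mem_singleton] at he
      rcases he with rfl | rfl
      · exact Finset.mem_sdiff.2 ⟨ha, haL⟩
      · exact Finset.mem_sdiff.2 ⟨hb, hbL⟩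
    have := Finset.card_le_card hsub
    rw [Finset.card_pair hab] at this
    exact this
  -- the case split on the heavy side lines
  by_cases hA : 2 ≤ (P₀.filter (fun e => e ∈ clF M Aset)).card ∧ ¬ rkN M (insert w₀ (insert x Aset)) ≤ 3
  · by_cases hM : 2 ≤ (P₀.filter (fun e => e ∈ clF M Mset)).card ∧ ¬ rkN M (insert w₀ (insert x Mset)) ≤ 3
    · -- both side lines heavy: the sets meeting both side cells
      rw [if_pos hA, if_pos hM] at hEcard
      apply basis_pair_fair_of_family_and_singletons hG hd hk hs hl hfat hB₀ hD hne hB hnP hz hl0 hw₀ hx hN3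
        (fun Y => (Y ∩ A').Nonempty ∧ (Y ∩ M').Nonempty) (E := E)
      · intro T hT hxT _ hPY
        obtain ⟨⟨a, ha⟩, ⟨q, hq⟩⟩ := hPY
        rw [Finset.mem_inter] at ha hq
        have haA : a ∈ Aset := (Finset.mem_filter.1 ha.2).2
        have hqM : q ∈ Mset := (Finset.mem_filter.1 hq.2).2
        have haq : a ≠ q := fun h => hAcM a haA (h ▸ hMcM q hqM)
        exact dload_eq_zero_of_dd_family hG hd hk hs hl hfat hB₀ hD hne hR₁V hR₁2 hR₁3 hc₂V hc₃V hc₂ hc₃ hcover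
          hdeg₂ hdeg₃ hB hnP hz hw₀ hx hT hxT
          (hspine _ a ha.1 q hq.1 haq (hAL a haA) (hML q hqM))
          ⟨fun _ hc => absurd hc hA.2, fun _ _ _ hsub => hMcA q hqM (hsub hq.1), fun _ hc => absurd hc hA.2⟩
          ⟨fun _ hc => absurd hc hM.2, fun _ _ _ hsub => hAcM a haA (hsub ha.1), fun _ hc => absurd hc hM.2⟩
      · exact hEW
      · exact hEun
      · have c3 : A'.card * M'.card ≤ ((W.powersetCard (3 - 1)).filter
            (fun Y => (Y ∩ A').Nonempty ∧ (Y ∩ M').Nonempty)).card :=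
          card_filter_meets_two_ge W A' M' hA'W hM'W hdAM
        have c4 : A'.card * M'.card * L'.card ≤ ((W.powersetCard (4 - 1)).filter
            (fun Y => (Y ∩ A').Nonempty ∧ (Y ∩ M').Nonempty)).card :=
          card_filter_meets_three_ge W A' M' L' hA'W hM'W hL'W hdAM hdAL hdML
        have hnum := dd_large_both _ _ _ _ _ _ _ _ _ _ h1 h3 h4 h5 h6 h7 h8 h9 h10 h11 hA.1 hM.1 (by omega)
        exact dd_bridge_large _ E.card (A'.card * M'.card) (A'.card * M'.card * L'.card) _ hN4 c3 c4 (by omega)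
    · -- `clF A` heavy, `clF M` not: two points of the `A`-cell and a point off `clF A`
      rw [if_pos hA, if_neg hM] at hEcard
      have hq := Finset.card_filter_add_card_filter_not (s := W) (fun e => e ∈ clF M Aset)
      apply basis_pair_fair_of_family_and_singletons hG hd hk hs hl hfat hB₀ hD hne hB hnP hz hl0 hw₀ hx hN3
        (fun Y => 2 ≤ (Y ∩ A').card ∧ ¬ Y ⊆ clF M Aset) (E := E)
      · intro T hT hxT _ hPY
        obtain ⟨hY2, hYA⟩ := hPY
        obtain ⟨a, ha⟩ : ((T \ insert z B).erase x ∩ A').Nonempty := by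
          rw [← Finset.card_pos]; omega
        rw [Finset.mem_inter] at ha
        have haA : a ∈ Aset := (Finset.mem_filter.1 ha.2).2
        have hsubL : (T \ insert z B).erase x ∩ A' ⊆ (T \ insert z B).erase x \ clF M R₁ := fun e he =>
          Finset.mem_sdiff.2 ⟨(Finset.mem_inter.1 he).1, hAL e (Finset.mem_filter.1 (Finset.mem_inter.1 he).2).2⟩
        have hsubM : (T \ insert z B).erase x ∩ A' ⊆ (T \ insert z B).erase x \ clF M Mset := fun e he =>
          Finset.mem_sdiff.2 ⟨(Finset.mem_inter.1 he).1, hAcM e (Finset.mem_filter.1 (Finset.mem_inter.1 he).2).2⟩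
        exact dload_eq_zero_of_dd_family hG hd hk hs hl hfat hB₀ hD hne hR₁V hR₁2 hR₁3 hc₂V hc₃V hc₂ hc₃ hcover
          hdeg₂ hdeg₃ hB hnP hz hw₀ hx hT hxT
          ⟨fun _ _ => hY2.trans (Finset.card_le_card hsubL), fun _ hc => absurd hcop hc,
            fun _ _ hsub => hAL a haA (hsub ha.1)⟩
          ⟨fun _ hc => absurd hc hA.2, fun _ _ _ => hYA, fun _ hc => absurd hc hA.2⟩
          ⟨fun _ _ => hY2.trans (Finset.card_le_card hsubM), fun _ _ _ hsub => hAcM a haA (hsub ha.1),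
            fun _ _ hsub => hAcM a haA (hsub ha.1)⟩
      · exact hEW
      · exact hEun
      · have c4 : A'.card.choose 2 * (W.filter (fun e => e ∉ clF M Aset)).card ≤ ((W.powersetCard (4 - 1)).filter
            (fun Y => 2 ≤ (Y ∩ A').card ∧ ¬ Y ⊆ clF M Aset)).card :=
          card_filter_two_off_ge W A' (clF M Aset) hA'W hA'C
        have hnum := dd_large_one (W.filter (fun e => e ∉ clF M Aset)).card A'.card (by omega) (by omega)
        exact dd_bridge_large _ E.card 0 (A'.card.choose 2 * (W.filter (fun e => e ∉ clF M Aset)).card) _ hN4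
          (Nat.zero_le _) c4 (by omega)
  · by_cases hM : 2 ≤ (P₀.filter (fun e => e ∈ clF M Mset)).card ∧ ¬ rkN M (insert w₀ (insert x Mset)) ≤ 3
    · -- `clF M` heavy, `clF A` not: two points of the `M`-cell and a point off `clF M`
      rw [if_neg hA, if_pos hM] at hEcard
      have hq := Finset.card_filter_add_card_filter_not (s := W) (fun e => e ∈ clF M Mset)
      apply basis_pair_fair_of_family_and_singletons hG hd hk hs hl hfat hB₀ hD hne hB hnP hz hl0 hw₀ hx hN3
        (fun Y => 2 ≤ (Y ∩ M').card ∧ ¬ Y ⊆ clF M Mset) (E := E)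
      · intro T hT hxT _ hPY
        obtain ⟨hY2, hYM⟩ := hPY
        obtain ⟨q, hq'⟩ : ((T \ insert z B).erase x ∩ M').Nonempty := by
          rw [← Finset.card_pos]; omega
        rw [Finset.mem_inter] at hq'
        have hqM : q ∈ Mset := (Finset.mem_filter.1 hq'.2).2
        have hsubL : (T \ insert z B).erase x ∩ M' ⊆ (T \ insert z B).erase x \ clF M R₁ := fun e he =>
          Finset.mem_sdiff.2 ⟨(Finset.mem_inter.1 he).1, hML e (Finset.mem_filter.1 (Finset.mem_inter.1 he).2).2⟩
        have hsubA : (T \ insert z B).erase x ∩ M' ⊆ (T \ insert z B).erase x \ clF M Aset := fun e he =>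
          Finset.mem_sdiff.2 ⟨(Finset.mem_inter.1 he).1, hMcA e (Finset.mem_filter.1 (Finset.mem_inter.1 he).2).2⟩
        exact dload_eq_zero_of_dd_family hG hd hk hs hl hfat hB₀ hD hne hR₁V hR₁2 hR₁3 hc₂V hc₃V hc₂ hc₃ hcover
          hdeg₂ hdeg₃ hB hnP hz hw₀ hx hT hxT
          ⟨fun _ _ => hY2.trans (Finset.card_le_card hsubL), fun _ hc => absurd hcop hc,
            fun _ _ hsub => hML q hqM (hsub hq'.1)⟩
          ⟨fun _ _ => hY2.trans (Finset.card_le_card hsubA), fun _ _ _ hsub => hMcA q hqM (hsub hq'.1),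
            fun _ _ hsub => hMcA q hqM (hsub hq'.1)⟩
          ⟨fun _ hc => absurd hc hM.2, fun _ _ _ => hYM, fun _ hc => absurd hc hM.2⟩
      · exact hEW
      · exact hEun
      · have c4 : M'.card.choose 2 * (W.filter (fun e => e ∉ clF M Mset)).card ≤ ((W.powersetCard (4 - 1)).filter
            (fun Y => 2 ≤ (Y ∩ M').card ∧ ¬ Y ⊆ clF M Mset)).card :=
          card_filter_two_off_ge W M' (clF M Mset) hM'W hM'C
        have hnum := dd_large_one (W.filter (fun e => e ∉ clF M Mset)).card M'.card (by omega) (by omega)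
        exact dd_bridge_large _ E.card 0 (M'.card.choose 2 * (W.filter (fun e => e ∉ clF M Mset)).card) _ hN4
          (Nat.zero_le _) c4 (by omega)
    · -- no heavy line: every singleton is unloaded
      rw [if_neg hA, if_neg hM] at hEcard
      apply basis_pair_fair_of_family_and_singletons hG hd hk hs hl hfat hB₀ hD hne hB hnP hz hl0 hw₀ hx hN3
        (fun _ => False) (E := E)
      · intro T _ _ _ hPY
        exact hPY.elim
      · exact hEW
      · exact hEun
      · exact dd_bridge_large _ E.card 0 0 _ hN4 (Nat.zero_le _) (Nat.zero_le _) (by omega)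

end PercRepro.Shadow
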